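import Literature.NumberTheory.Sieve.CFSemigroupDimension
import Literature.NumberTheory.Sieve.CFSemigroupLimitSet
import HarnessLib

/-!
# The limit set of `Γ_A` is the continued-fraction Cantor set `E_A` (support for `CFSemigroupCounting`)

`CFSemigroupCounting.lean` defines `δ_A := dim_H Λ(Γ_A)` with `Λ(Γ_A)` the set of accumulation
points in `ℂ` of the orbit `Γ_A · i` [MageeOhWinter2019, §1], and remarks that its identification
with the Cantor set `E_A = {[0; a₁, a₂, …] : aᵢ ∈ A}` (Hensley's `δ_A`; the `T`-invariant set
`K ⊆ I_A` of [MageeOhWinter2019, §2.1 II, §2.2], `δ = dim_H K`) "is standard but not asserted".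
This file PROVES it:

* `cfCantorSet A = {cfValue d : d ∈ A^ℕ} ⊆ ℝ` (`E_A`);
* `cfLimitSet_eq_image_cfCantorSet`: `Λ(Γ_A) = E_A` (as a subset of `ℝ ⊆ ℂ`) for every finite
  `A ⊆ ℕ_{≥1}`; `⊇` is `cfValue_mem_cfLimitSet` (`CFSemigroupDimension.lean`); for `⊆`, an
  accumulation point `x` (real, by `CFSemigroupLimitSet.lean`) is a limit of orbit points
  `M_{n_k}(d_k) · i` with `n_k → ∞`; a subsequence of the digit sequences converges letterwise
  (compactness of `A^ℕ`) to some `d ∈ A^ℕ`, and `|M_n(d_k) · i - x_n(d_k)| ≤ 1/q_n`,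
  `|x_n(d_k) - [0; d]| ≤ 6 · 2^{-m}` once `d_k` and `d` agree below `m ≤ n`, force `x = [0; d]`;
* `cfDimension_eq_toReal_dimH_cfCantorSet`: `δ_A = dim_H E_A`; `isCompact_cfCantorSet`: `E_A ⊆ [0,1]` is compact.

All statements are proved (folklore).

## References

* M. Magee, H. Oh, D. Winter, J. reine angew. Math. 753 (2019) 89–135, §1, §2.1 II, §2.2. [MageeOhWinter2019]
-/

noncomputable section

open Filter Set
open scoped Topology MatrixGroups

namespace Literature.NumberTheory.Sieve

/-! ### The Cantor set `E_A` and tail estimates -/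

/-- The continued-fraction Cantor set `E_A = {[0; a₁, a₂, …] : aᵢ ∈ A} ⊆ ℝ` of reals in `[0,1]`
all of whose partial quotients lie in `A`. [cite: MageeOhWinter2019, §1] -/
def cfCantorSet (A : Finset ℕ) : Set ℝ :=
  {x | ∃ d : ℕ → ℕ, (∀ i, d i ∈ A) ∧ x = cfValue d}

/-- `q_n ≥ n`. [folklore] -/
theorem le_cfDen {d : ℕ → ℕ} (hd : ∀ i, 1 ≤ d i) : ∀ n : ℕ, (n : ℤ) ≤ cfDen d n
  | 0 => by simp
  | 1 => by simpa using hd 0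
  | n + 2 => by
      have h0 : (1 : ℤ) ≤ cfDen d n := one_le_cfDen hd n
      have h1 := le_cfDen hd (n + 1)
      have hdig : (1 : ℤ) ≤ d (n + 1) := by exact_mod_cast hd (n + 1)
      have h1' : (0 : ℤ) ≤ cfDen d (n + 1) := by
        have := one_le_cfDen hd (n + 1); linarith
      have h1'' : (n : ℤ) + 1 ≤ cfDen d (n + 1) := by exact_mod_cast h1
      have hmul : cfDen d (n + 1) * 1 ≤ cfDen d (n + 1) * d (n + 1) :=
        mul_le_mul_of_nonneg_left hdig h1'
      rw [cfDen_add_two]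
      push_cast
      nlinarith

/-- Tail of the telescoping series: `|x_n - [0; d]| ≤ 2 · 2^{-n}`. [folklore] -/
theorem abs_cfConv_sub_cfValue_le {d : ℕ → ℕ} (hd : ∀ i, 1 ≤ d i) (n : ℕ) :
    |cfConv d n - cfValue d| ≤ 2 * ((1 : ℝ) / 2) ^ n := by
  have hs := summable_cfConv_succ_sub hd
  have hs' : Summable fun i => cfConv d (i + n + 1) - cfConv d (i + n) :=
    (summable_nat_add_iff n).2 hs
  have hsplit := hs.sum_add_tsum_nat_add n
  rw [Finset.sum_range_sub, cfConv_zero, sub_zero] at hsplit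
  have htail : cfValue d - cfConv d n = ∑' i, (cfConv d (i + n + 1) - cfConv d (i + n)) := by
    rw [cfValue, ← hsplit]; ring
  have hb : ∀ i, ‖cfConv d (i + n + 1) - cfConv d (i + n)‖ ≤ ((1 : ℝ) / 2) ^ n * ((1 : ℝ) / 2) ^ i :=
    fun i => by
      rw [Real.norm_eq_abs, ← pow_add, add_comm n i]
      exact abs_cfConv_succ_sub_le hd (i + n)
  have hg : Summable fun i => ((1 : ℝ) / 2) ^ n * ((1 : ℝ) / 2) ^ i :=
    summable_geometric_two.mul_left _
  have hn : Summable fun i => ‖cfConv d (i + n + 1) - cfConv d (i + n)‖ :=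
    Summable.of_nonneg_of_le (fun _ => norm_nonneg _) hb hg
  rw [abs_sub_comm, htail]
  calc |∑' i, (cfConv d (i + n + 1) - cfConv d (i + n))|
      = ‖∑' i, (cfConv d (i + n + 1) - cfConv d (i + n))‖ := (Real.norm_eq_abs _).symm
    _ ≤ ∑' i, ‖cfConv d (i + n + 1) - cfConv d (i + n)‖ := norm_tsum_le_tsum_norm hn
    _ ≤ ∑' i, ((1 : ℝ) / 2) ^ n * ((1 : ℝ) / 2) ^ i := hn.tsum_le_tsum hb hg
    _ = 2 * ((1 : ℝ) / 2) ^ n := by rw [tsum_mul_left, tsum_geometric_two, mul_comm]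

/-- If `d, d'` (digits `≥ 1`) agree below `m ≤ n`, then `|x_n(d) - [0; d']| ≤ 6 · 2^{-m}`.
[folklore] -/
theorem abs_cfConv_sub_cfValue_le_of_agree {d d' : ℕ → ℕ} (hd : ∀ i, 1 ≤ d i)
    (hd' : ∀ i, 1 ≤ d' i) {m n : ℕ} (hagree : ∀ i < m, d i = d' i) (hmn : m ≤ n) :
    |cfConv d n - cfValue d'| ≤ 6 * ((1 : ℝ) / 2) ^ m := by
  have h1 := abs_cfConv_sub_cfValue_le hd n
  have h2 := abs_cfConv_sub_cfValue_le hd m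
  have h3 := abs_cfConv_sub_cfValue_le hd' m
  have heq : cfConv d m = cfConv d' m := by
    simp only [cfConv, cfNum, cfDen, cfWord_congr hagree]
  have hpow : ((1 : ℝ) / 2) ^ n ≤ ((1 : ℝ) / 2) ^ m :=
    pow_le_pow_of_le_one (by norm_num) (by norm_num) hmn
  have htri : |cfConv d n - cfValue d'| ≤
      |cfConv d n - cfValue d| + |cfConv d m - cfValue d| + |cfConv d' m - cfValue d'| := by
    have := abs_sub_le (cfConv d n) (cfValue d) (cfValue d')
    have := abs_sub_le (cfValue d) (cfConv d m) (cfValue d')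
    rw [heq] at *
    have := abs_sub_comm (cfValue d) (cfConv d' m)
    linarith
  linarith

/-- Every element of `Γ_A` is a word matrix `M_{m+1}(d)` with `d i ∈ A` for `i ≤ m` (and the
irrelevant digits beyond the word equal to `1`). [folklore] -/
theorem exists_eq_cfWord_of_mem_cfSemigroup' {A : Finset ℕ} {M : Matrix (Fin 2) (Fin 2) ℤ}
    (hM : M ∈ cfSemigroup A) :
    ∃ d : ℕ → ℕ, (∀ i, d i ∈ A ∨ d i = 1) ∧
      ∃ m : ℕ, (∀ i < m + 1, d i ∈ A) ∧ M = cfWord d (m + 1) := by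
  obtain ⟨w, hw, -, hwA, rfl⟩ := hM
  obtain ⟨m, hm⟩ : ∃ m, w.length = m + 1 :=
    Nat.exists_eq_add_one.2 (List.length_pos_iff.2 hw)
  have hin : ∀ i < m + 1, w.getD i 1 ∈ A := fun i hi => by
    rw [← hm] at hi
    rw [List.getD_eq_getElem _ _ hi]
    exact hwA _ (List.getElem_mem hi)
  refine ⟨fun i => w.getD i 1, fun i => ?_, m, hin, ?_⟩
  · by_cases hi : i < m + 1
    · exact Or.inl (hin i hi)
    · right
      show w.getD i 1 = 1
      rw [List.getD_eq_default]
      omega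
  · rw [cfWord_eq_prod, ← hm, map_getD_range_eq]

/-! ### `Λ(Γ_A) = E_A` -/

/-- **`Λ(Γ_A) ⊆ E_A`**: every accumulation point of the orbit `Γ_A · i` is the value of an
infinite continued fraction with all partial quotients in `A`. [cite: MageeOhWinter2019, §1 and §2.1 II] -/
theorem cfLimitSet_subset_image_cfCantorSet {A : Finset ℕ} (hA : ∀ a ∈ A, 1 ≤ a) :
    cfLimitSet A ⊆ (fun x : ℝ => (x : ℂ)) '' cfCantorSet A := by
  intro z hz
  obtain ⟨x, -, rfl⟩ := cfLimitSet_subset_image_Icc hA hz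
  rw [cfLimitSet_eq_derivedSet, mem_derivedSet, accPt_iff_nhds] at hz
  -- a sequence of orbit points `γ_k · i → x`
  have hseq : ∀ k : ℕ, ∃ γ : SL(2, ℤ), (γ : Matrix (Fin 2) (Fin 2) ℤ) ∈ cfSemigroup A ∧
      dist ((γ • UpperHalfPlane.I : UpperHalfPlane) : ℂ) (x : ℂ) < 1 / ((k : ℝ) + 1) := by
    intro k
    obtain ⟨y, ⟨hyU, γ, hγ, rfl⟩, -⟩ := hz _ (Metric.ball_mem_nhds (x : ℂ)
      (by positivity : (0 : ℝ) < 1 / ((k : ℝ) + 1)))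
    exact ⟨γ, hγ, hyU⟩
  choose γ hγmem hγdist using hseq
  -- digits of the `γ_k`: `γ_k = M_{n_k + 1}(d_k)`
  have hdig : ∀ k, ∃ d : ℕ → ℕ, (∀ i, d i ∈ A ∨ d i = 1) ∧ ∃ m : ℕ, (∀ i < m + 1, d i ∈ A) ∧
      (γ k : Matrix (Fin 2) (Fin 2) ℤ) = cfWord d (m + 1) := fun k =>
    exists_eq_cfWord_of_mem_cfSemigroup' (hγmem k)
  choose d hdA1 n hdA hγeq using hdig
  have hd1 : ∀ k i, 1 ≤ d k i := fun k i => (hdA1 k i).elim (hA _) fun h => h ▸ le_rfl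
  have ha₀ : d 0 0 ∈ A := hdA 0 0 (Nat.succ_pos _)
  -- `B` bounds all digits
  set B : ℕ := A.sup id with hB
  have hleB : ∀ a ∈ A, a ≤ B := fun a ha => Finset.le_sup (f := id) ha
  have hB1 : 1 ≤ B := (hA _ ha₀).trans (hleB _ ha₀)
  have hdB : ∀ k i, d k i ≤ B := fun k i => (hdA1 k i).elim (hleB _) fun h => h ▸ hB1
  -- imaginary parts: `Im(γ_k · i) < 1/(k+1)` and `Im(γ_k · i) ≥ 1/(2 (B+1)^{2(n_k+1)})`
  have hIm_lt : ∀ k, ((γ k • UpperHalfPlane.I : UpperHalfPlane) : ℂ).im < 1 / ((k : ℝ) + 1) := by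
    intro k
    have h := hγdist k
    rw [Complex.dist_eq] at h
    have him := Complex.abs_im_le_norm
      (((γ k • UpperHalfPlane.I : UpperHalfPlane) : ℂ) - (x : ℂ))
    rw [Complex.sub_im, Complex.ofReal_im, sub_zero] at him
    exact ((le_abs_self _).trans him).trans_lt h
  have hIm_ge : ∀ k, 1 / (2 * (((B : ℝ) + 1) ^ 2) ^ (n k + 1)) ≤
      ((γ k • UpperHalfPlane.I : UpperHalfPlane) : ℂ).im := by
    intro k
    obtain ⟨-, him⟩ := re_im_smul_I_of_mem_cfSemigroup hA (γ k) (hγmem k)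
    rw [him, hγeq k, cfWord_succ_10]
    show 1 / (2 * (((B : ℝ) + 1) ^ 2) ^ (n k + 1)) ≤
      1 / ((cfDen (d k) (n k) : ℝ) ^ 2 + (cfDen (d k) (n k + 1) : ℝ) ^ 2)
    have h1 : (cfDen (d k) (n k) : ℝ) ≤ cfDen (d k) (n k + 1) := by
      exact_mod_cast cfDen_le_succ (hd1 k) (n k)
    have h2 : (cfDen (d k) (n k + 1) : ℝ) ≤ ((B : ℝ) + 1) ^ (n k + 1) := by
      exact_mod_cast cfDen_le_pow (hd1 k) (hdB k) (n k + 1)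
    have h0 : (0 : ℝ) < cfDen (d k) (n k) := cfDen_cast_pos (hd1 k) _
    refine one_div_le_one_div_of_le (by positivity) ?_
    rw [← pow_mul, mul_comm 2 (n k + 1), pow_mul]
    nlinarith [pow_le_pow_left₀ (h0.le.trans h1) h2 2]
  -- hence `n_k → ∞`
  have hn_tend : Tendsto n atTop atTop := by
    refine tendsto_atTop.2 fun m => ?_
    have hη : (0 : ℝ) < 1 / (2 * (((B : ℝ) + 1) ^ 2) ^ (m + 1)) := by positivity
    have hev : ∀ᶠ k : ℕ in atTop, 1 / ((k : ℝ) + 1) < 1 / (2 * (((B : ℝ) + 1) ^ 2) ^ (m + 1)) :=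
      tendsto_one_div_add_atTop_nhds_zero_nat.eventually (gt_mem_nhds hη)
    filter_upwards [hev] with k hk
    by_contra hlt
    rw [not_le] at hlt
    have hB1' : (1 : ℝ) ≤ B := by exact_mod_cast hB1
    have hL1 : (1 : ℝ) ≤ ((B : ℝ) + 1) ^ 2 := by nlinarith
    have hpow : (((B : ℝ) + 1) ^ 2) ^ (n k + 1) ≤ (((B : ℝ) + 1) ^ 2) ^ (m + 1) :=
      pow_le_pow_right₀ hL1 (by omega)
    have h3 : 1 / (2 * (((B : ℝ) + 1) ^ 2) ^ (m + 1)) ≤ 1 / (2 * (((B : ℝ) + 1) ^ 2) ^ (n k + 1)) :=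
      one_div_le_one_div_of_le (by positivity) (by linarith)
    linarith [hIm_ge k, hIm_lt k]
  -- compactness of `A^ℕ`: a letterwise convergent subsequence of the digit sequences
  let D : ℕ → (ℕ → A) := fun k i => if h : d k i ∈ A then ⟨d k i, h⟩ else ⟨d 0 0, ha₀⟩
  obtain ⟨D₀, φ, hφ, hlim⟩ := SeqCompactSpace.tendsto_subseq D
  have hpt : ∀ i, ∀ᶠ j in atTop, D (φ j) i = D₀ i := fun i => by
    have h := tendsto_pi_nhds.1 hlim i
    rw [nhds_discrete, tendsto_pure] at h
    exact h
  set e : ℕ → ℕ := fun i => ((D₀ i : A) : ℕ) with he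
  have heA : ∀ i, e i ∈ A := fun i => (D₀ i).2
  have he1 : ∀ i, 1 ≤ e i := fun i => hA _ (heA i)
  have hagree : ∀ m, ∀ᶠ j in atTop, (∀ i < m, d (φ j) i = e i) ∧ m ≤ n (φ j) := by
    intro m
    have h1 : ∀ᶠ j in atTop, ∀ i ∈ Finset.range m, D (φ j) i = D₀ i :=
      (Finset.range m).eventually_all.2 fun i _ => hpt i
    have h2 : ∀ᶠ j in atTop, m ≤ n (φ j) := hφ.tendsto_atTop.eventually (tendsto_atTop.1 hn_tend m)
    filter_upwards [h1, h2] with j hj1 hj2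
    refine ⟨fun i hi => ?_, hj2⟩
    have hiA : d (φ j) i ∈ A := hdA (φ j) i (by omega)
    have h := hj1 i (Finset.mem_range.2 hi)
    simp only [D, dif_pos hiA] at h
    simpa [he] using congrArg Subtype.val h
  -- the convergents along the subsequence tend to `x`
  have hconv : Tendsto (fun j => cfConv (d (φ j)) (n (φ j) + 1)) atTop (𝓝 x) := by
    rw [tendsto_iff_norm_sub_tendsto_zero]
    have hbound : ∀ j, ‖cfConv (d (φ j)) (n (φ j) + 1) - x‖ ≤
        1 / ((n (φ j) : ℝ) + 1) + 1 / ((φ j : ℝ) + 1) := by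
      intro j
      have h1 := norm_smul_I_sub_cfConv_le (hd1 (φ j)) (γ (φ j)) (hγeq (φ j))
      have h2 := hγdist (φ j)
      have h3 : 1 / (cfDen (d (φ j)) (n (φ j) + 1) : ℝ) ≤ 1 / ((n (φ j) : ℝ) + 1) := by
        refine one_div_le_one_div_of_le (by positivity) ?_
        have h := le_cfDen (hd1 (φ j)) (n (φ j) + 1)
        exact_mod_cast h
      have h4 : ‖cfConv (d (φ j)) (n (φ j) + 1) - x‖ =
          ‖((cfConv (d (φ j)) (n (φ j) + 1) : ℝ) : ℂ) - (x : ℂ)‖ := by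
        rw [← Complex.ofReal_sub, Complex.norm_real]
      rw [h4]
      calc ‖((cfConv (d (φ j)) (n (φ j) + 1) : ℝ) : ℂ) - (x : ℂ)‖
          ≤ ‖((cfConv (d (φ j)) (n (φ j) + 1) : ℝ) : ℂ) -
                ((γ (φ j) • UpperHalfPlane.I : UpperHalfPlane) : ℂ)‖ +
              ‖((γ (φ j) • UpperHalfPlane.I : UpperHalfPlane) : ℂ) - (x : ℂ)‖ :=
            norm_sub_le_norm_sub_add_norm_sub _ _ _
        _ ≤ 1 / ((n (φ j) : ℝ) + 1) + 1 / ((φ j : ℝ) + 1) := by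
            refine add_le_add ?_ ?_
            · rw [norm_sub_rev]; exact h1.trans h3
            · rw [← dist_eq_norm]; exact h2.le
    refine squeeze_zero (fun j => norm_nonneg _) hbound ?_
    rw [← zero_add (0 : ℝ)]
    exact (tendsto_one_div_add_atTop_nhds_zero_nat.comp (hn_tend.comp hφ.tendsto_atTop)).add
      (tendsto_one_div_add_atTop_nhds_zero_nat.comp hφ.tendsto_atTop)
  -- conclusion: `x = [0; e]`
  have hxe : ∀ m, |x - cfValue e| ≤ 6 * ((1 : ℝ) / 2) ^ m := fun m => by
    have hlim2 : Tendsto (fun j => |cfConv (d (φ j)) (n (φ j) + 1) - cfValue e|) atTop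
        (𝓝 |x - cfValue e|) := (hconv.sub tendsto_const_nhds).abs
    refine le_of_tendsto hlim2 ?_
    filter_upwards [hagree m] with j hj
    exact abs_cfConv_sub_cfValue_le_of_agree (hd1 (φ j)) he1 hj.1 (hj.2.trans (Nat.le_succ _))
  have hgeom : Tendsto (fun m : ℕ => 6 * ((1 : ℝ) / 2) ^ m) atTop (𝓝 0) := by
    simpa using (tendsto_pow_atTop_nhds_zero_of_lt_one (by norm_num : (0 : ℝ) ≤ 1 / 2)
      (by norm_num)).const_mul (6 : ℝ)
  have h0 : |x - cfValue e| ≤ 0 := ge_of_tendsto hgeom (Eventually.of_forall hxe)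
  exact ⟨x, ⟨e, heA, eq_of_abs_sub_nonpos h0⟩, rfl⟩

/-- **`Λ(Γ_A) = E_A`.** The limit set of the continued fractions semigroup `Γ_A` (accumulation
points in `ℂ` of `Γ_A · i`) is exactly the Cantor set `E_A` of infinite continued fractions with
partial quotients in `A`, embedded in `ℝ ⊆ ℂ` (`A ⊆ ℕ_{≥1}` finite). [cite: MageeOhWinter2019, §1 and §2.1 II] -/
theorem cfLimitSet_eq_image_cfCantorSet {A : Finset ℕ} (hA : ∀ a ∈ A, 1 ≤ a) :
    cfLimitSet A = (fun x : ℝ => (x : ℂ)) '' cfCantorSet A := by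
  refine (cfLimitSet_subset_image_cfCantorSet hA).antisymm ?_
  rintro _ ⟨x, ⟨d, hd, rfl⟩, rfl⟩
  exact cfValue_mem_cfLimitSet hA hd

/-- **`δ_A = dim_H E_A`.** The dimension `cfDimension A` of the named fact equals the Hausdorff
dimension of the continued-fraction Cantor set `E_A ⊆ ℝ` (Hensley's `δ_A`; the `δ = dim_H K` of
[MageeOhWinter2019, §2.2]). [cite: MageeOhWinter2019, §1 and §2.2] -/
theorem cfDimension_eq_toReal_dimH_cfCantorSet {A : Finset ℕ} (hA : ∀ a ∈ A, 1 ≤ a) :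
    cfDimension A = (dimH (cfCantorSet A)).toReal := by
  rw [cfDimension, cfLimitSet_eq_image_cfCantorSet hA, Complex.isometry_ofReal.dimH_image]


/-- `E_A ⊆ [0, 1]` (`A ⊆ ℕ_{≥1}`). [folklore] -/
theorem cfCantorSet_subset_Icc {A : Finset ℕ} (hA : ∀ a ∈ A, 1 ≤ a) :
    cfCantorSet A ⊆ Icc (0 : ℝ) 1 := by
  rintro _ ⟨d, hd, rfl⟩
  exact cfValue_mem_Icc fun i => hA _ (hd i)

/-- `E_A` is closed: it is the derived set of the orbit `Γ_A · i`, read in `ℝ`. [folklore] -/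
theorem isClosed_cfCantorSet {A : Finset ℕ} (hA : ∀ a ∈ A, 1 ≤ a) : IsClosed (cfCantorSet A) := by
  have h : IsClosed (cfLimitSet A) := by
    rw [cfLimitSet_eq_derivedSet]
    exact isClosed_derivedSet _
  rw [cfLimitSet_eq_image_cfCantorSet hA] at h
  exact (Complex.isometry_ofReal.isClosedEmbedding.isClosed_iff_image_isClosed).2 h

/-- `E_A` is compact. [folklore] -/
theorem isCompact_cfCantorSet {A : Finset ℕ} (hA : ∀ a ∈ A, 1 ≤ a) : IsCompact (cfCantorSet A) :=
  isCompact_Icc.of_isClosed_subset (isClosed_cfCantorSet hA) (cfCantorSet_subset_Icc hA)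

end Literature.NumberTheory.Sieve
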